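import Literature.Topology.FourManifolds.OneManifoldArcGluing
import Literature.Topology.FourManifolds.OneManifoldVectorField
import HarnessLib

/-!
# Local orders on a `1`-manifold: germs of "same direction", smooth charts versus arc charts

Topic `Literature/Topology/FourManifolds`. Technical companion of `OneManifoldOrientable.lean`
(every compact connected `1`-manifold is orientable), linking the *topological* output of
Milnor's classification argument (`OneManifoldTwoCharts.lean`: two arc charts `e`, `f` covering
`M` with `e q < e p ↔ f q < f p` near each point `p` of the overlap) to the *smooth* notion of
orientation of the tree (`Literature.Topology.FourManifolds.SmoothOrientation`: signs of the
Jacobians `tangentCoordChange (𝓡 1) y x y` of the changes of preferred charts).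

Two real functions `u`, `v` on a space **have the same direction at `p`** if
`u q < u p ↔ v q < v p` and `u p < u q ↔ v p < v q` for all `q` near `p`, and **opposite
directions** if `u q < u p ↔ v p < v q` and `u p < u q ↔ v q < v p` near `p`. (No definition is
introduced; the statements spell these germs out.) Contents, all **proved**:

* the calculus of these germs (`same_trans`, `opp_opp`, …, `not_same_and_opp`: a function which
  is not locally constant at `p` cannot have both the same and the opposite direction as another
  one; `same_iff_same_iff`: the sign rule used by the orientation argument);
* `exists_interval_strictMonoOn_or_strictAntiOn`: a continuous injective real function `c` near a
  point `x` of the source of a real chart `e` is, read in `e`, strictly monotone on an interval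
  around `e x` — so `c` and `e` have the same or opposite directions at all points of an
  `e`-interval around `x` (`eventually_lt_iff_of_strictMonoOn`, `OneManifoldArcGluing.lean`);
* charts are not locally constant (`not_eventually_chart_eq`, `not_eventually_coord_eq`);
* `same_coord_iff_det_pos` (**the bridge to the smooth structure**): for the coordinates
  `c_x = (extChartAt (𝓡 1) x ·) 0`, `c_y` of the preferred charts at `x` and `y` of a `C¹`
  manifold modelled on `ℝ¹`, `c_x` and `c_y` have the same direction at `y` iff the Jacobian
  `det (tangentCoordChange (𝓡 1) y x y)` is positive — the first-order Taylor estimate of the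
  chart change at `extChartAt (𝓡 1) y y`, in dimension one.

## References

* J. Milnor, *Topology from the Differentiable Viewpoint*, Univ. Press of Virginia (1965),
  Appendix "Classifying 1-manifolds", pp. 55–57. [MilnorTDV1965]
* M. W. Hirsch, *Differential Topology*, GTM 33 (1976), §4.4 (orientations by signs of
  Jacobians). [HirschDT1976]
-/

open Set Filter Topology Module
open scoped Manifold ContDiff

noncomputable section

namespace Literature.Topology.FourManifolds

namespace OneManifold

/-! ### Germs of "same direction" and "opposite direction" -/

section Germs

variable {X : Type*} [TopologicalSpace X] {u v w : X → ℝ} {p : X}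

/-- Same direction is symmetric. [folklore] -/
theorem same_symm (h : ∀ᶠ q in 𝓝 p, (u q < u p ↔ v q < v p) ∧ (u p < u q ↔ v p < v q)) :
    ∀ᶠ q in 𝓝 p, (v q < v p ↔ u q < u p) ∧ (v p < v q ↔ u p < u q) := by
  filter_upwards [h] with q hq using ⟨hq.1.symm, hq.2.symm⟩

/-- Same direction is transitive. [folklore] -/
theorem same_trans (h : ∀ᶠ q in 𝓝 p, (u q < u p ↔ v q < v p) ∧ (u p < u q ↔ v p < v q))
    (h' : ∀ᶠ q in 𝓝 p, (v q < v p ↔ w q < w p) ∧ (v p < v q ↔ w p < w q)) :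
    ∀ᶠ q in 𝓝 p, (u q < u p ↔ w q < w p) ∧ (u p < u q ↔ w p < w q) := by
  filter_upwards [h, h'] with q hq hq' using ⟨hq.1.trans hq'.1, hq.2.trans hq'.2⟩

/-- Opposite direction is symmetric. [folklore] -/
theorem opp_symm (h : ∀ᶠ q in 𝓝 p, (u q < u p ↔ v p < v q) ∧ (u p < u q ↔ v q < v p)) :
    ∀ᶠ q in 𝓝 p, (v q < v p ↔ u p < u q) ∧ (v p < v q ↔ u q < u p) := by
  filter_upwards [h] with q hq using ⟨hq.2.symm, hq.1.symm⟩

/-- Opposite followed by same is opposite. [folklore] -/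
theorem opp_same (h : ∀ᶠ q in 𝓝 p, (u q < u p ↔ v p < v q) ∧ (u p < u q ↔ v q < v p))
    (h' : ∀ᶠ q in 𝓝 p, (v q < v p ↔ w q < w p) ∧ (v p < v q ↔ w p < w q)) :
    ∀ᶠ q in 𝓝 p, (u q < u p ↔ w p < w q) ∧ (u p < u q ↔ w q < w p) := by
  filter_upwards [h, h'] with q hq hq' using ⟨hq.1.trans hq'.2, hq.2.trans hq'.1⟩

/-- Opposite followed by opposite is same. [folklore] -/
theorem opp_opp (h : ∀ᶠ q in 𝓝 p, (u q < u p ↔ v p < v q) ∧ (u p < u q ↔ v q < v p))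
    (h' : ∀ᶠ q in 𝓝 p, (v q < v p ↔ w p < w q) ∧ (v p < v q ↔ w q < w p)) :
    ∀ᶠ q in 𝓝 p, (u q < u p ↔ w q < w p) ∧ (u p < u q ↔ w p < w q) := by
  filter_upwards [h, h'] with q hq hq' using ⟨hq.1.trans hq'.2, hq.2.trans hq'.1⟩

/-- **A function which is not locally constant at `p` cannot have both the same and the opposite
direction as another function at `p`**: both together force `v q = v p` near `p`. [folklore] -/
theorem not_same_and_opp (hv : ¬∀ᶠ q in 𝓝 p, v q = v p)
    (h : ∀ᶠ q in 𝓝 p, (u q < u p ↔ v q < v p) ∧ (u p < u q ↔ v p < v q))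
    (h' : ∀ᶠ q in 𝓝 p, (u q < u p ↔ v p < v q) ∧ (u p < u q ↔ v q < v p)) : False := by
  apply hv
  filter_upwards [h, h'] with q hq hq'
  have h1 : v q < v p ↔ v p < v q := hq.1.symm.trans hq'.1
  rcases lt_trichotomy (v q) (v p) with hlt | heq | hgt
  · exact absurd (h1.1 hlt) hlt.not_gt
  · exact heq
  · exact absurd (h1.2 hgt) hgt.not_gt

/-- **The sign rule.** Let `r` be a reference function and suppose `a`, `b` each have the same or
the opposite direction as `r` at `p`, where `r` and `a` are not locally constant at `p`. Then
"`a` has the same direction as `r` iff `b` does" holds iff `b` and `a` have the same direction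
at `p` (`(+)(+) = (-)(-) = +`, `(+)(-) = -`). [folklore] -/
theorem same_iff_same_iff {a b r : X → ℝ} (hr : ¬∀ᶠ q in 𝓝 p, r q = r p)
    (ha : ¬∀ᶠ q in 𝓝 p, a q = a p)
    (hP : (∀ᶠ q in 𝓝 p, (a q < a p ↔ r q < r p) ∧ (a p < a q ↔ r p < r q)) ∨
      ∀ᶠ q in 𝓝 p, (a q < a p ↔ r p < r q) ∧ (a p < a q ↔ r q < r p))
    (hQ : (∀ᶠ q in 𝓝 p, (b q < b p ↔ r q < r p) ∧ (b p < b q ↔ r p < r q)) ∨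
      ∀ᶠ q in 𝓝 p, (b q < b p ↔ r p < r q) ∧ (b p < b q ↔ r q < r p)) :
    ((∀ᶠ q in 𝓝 p, (a q < a p ↔ r q < r p) ∧ (a p < a q ↔ r p < r q)) ↔
      ∀ᶠ q in 𝓝 p, (b q < b p ↔ r q < r p) ∧ (b p < b q ↔ r p < r q)) ↔
      ∀ᶠ q in 𝓝 p, (b q < b p ↔ a q < a p) ∧ (b p < b q ↔ a p < a q) := by
  rcases hP with hP | hP <;> rcases hQ with hQ | hQ
  · exact iff_of_true (iff_of_true hP hQ) (same_trans hQ (same_symm hP))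
  · refine iff_of_false (fun h => not_same_and_opp hr (h.1 hP) hQ) fun h => ?_
    exact not_same_and_opp ha h (opp_same hQ (same_symm hP))
  · refine iff_of_false (fun h => not_same_and_opp hr (h.2 hQ) hP) fun h => ?_
    exact not_same_and_opp ha h (opp_symm (opp_same hP (same_symm hQ)))
  · exact iff_of_true (iff_of_false (fun h => not_same_and_opp hr h hP)
      fun h => not_same_and_opp hr h hQ) (opp_opp hQ (opp_symm hP))

/-- Two orientations written as `if · then μ₀ else -μ₀` agree iff the conditions agree (an
orientation differs from its opposite, `Module.Ray.ne_neg_self`). [folklore] -/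
theorem ite_eq_ite_iff_iff {E : Type*} [NormedAddCommGroup E] [NormedSpace ℝ E]
    (μ₀ : Orientation ℝ E (Fin (finrank ℝ E))) (P Q : Prop) [Decidable P] [Decidable Q] :
    ((if P then μ₀ else -μ₀) = if Q then μ₀ else -μ₀) ↔ (P ↔ Q) := by
  have hμ : μ₀ ≠ -μ₀ := Module.Ray.ne_neg_self μ₀
  by_cases hP : P <;> by_cases hQ : Q <;> simp [hP, hQ, hμ, hμ.symm]

end Germs

/-! ### A continuous injective function read in a real chart is monotone on an interval -/

section RealChart

variable {M : Type*} [TopologicalSpace M] {e : OpenPartialHomeomorph M ℝ} {x : M}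

/-- **A continuous injective real function is monotone near any point when read in a real
chart.** If `c` is continuous and injective on an open `U ∋ x` and `x ∈ e.source`, there is an
open interval `J ∋ e x` inside `e.target` with `e.symm '' J ⊆ U` on which `c ∘ e.symm` is strictly
increasing or strictly decreasing (`strictMonoOn_or_strictAntiOn_of_continuousOn`). [folklore] -/
theorem exists_interval_strictMonoOn_or_strictAntiOn {c : M → ℝ} {U : Set M} (hUo : IsOpen U)
    (hxU : x ∈ U) (hc : ContinuousOn c U) (hinj : InjOn c U) (hx : x ∈ e.source) :
    ∃ J : Set ℝ, IsOpen J ∧ e x ∈ J ∧ J ⊆ e.target ∧ e.symm '' J ⊆ U ∧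
      (StrictMonoOn (c ∘ e.symm) J ∨ StrictAntiOn (c ∘ e.symm) J) := by
  have hWo : IsOpen (e.target ∩ e.symm ⁻¹' U) := e.isOpen_inter_preimage_symm hUo
  have hxW : e x ∈ e.target ∩ e.symm ⁻¹' U :=
    ⟨e.map_source hx, by rw [mem_preimage, e.left_inv hx]; exact hxU⟩
  obtain ⟨δ, hδ, hball⟩ := Metric.isOpen_iff.1 hWo (e x) hxW
  rw [Real.ball_eq_Ioo] at hball
  refine ⟨Ioo (e x - δ) (e x + δ), isOpen_Ioo, ⟨by linarith, by linarith⟩,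
    fun t ht => (hball ht).1, ?_, ?_⟩
  · rintro _ ⟨t, ht, rfl⟩
    exact (hball ht).2
  · refine strictMonoOn_or_strictAntiOn_of_continuousOn ordConnected_Ioo ?_ ?_
    · exact hc.comp (e.continuousOn_symm.mono fun t ht => (hball ht).1) fun t ht => (hball ht).2
    · intro s hs t ht hst
      have h1 : e.symm s = e.symm t := hinj (hball hs).2 (hball ht).2 hst
      rw [← e.right_inv (hball hs).1, ← e.right_inv (hball ht).1, h1]

/-- A real chart is not locally constant at a point of its source: the image of a neighbourhood
is a neighbourhood of `e x` in `ℝ`, which is not a singleton. [folklore] -/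
theorem not_eventually_chart_eq (hx : x ∈ e.source) : ¬∀ᶠ q in 𝓝 x, e q = e x := by
  intro h
  have himg : e '' {q | e q = e x} ∈ 𝓝 (e x) := e.image_mem_nhds hx h
  obtain ⟨ε, hε, hball⟩ := Metric.mem_nhds_iff.1 himg
  obtain ⟨q, hq, hqx⟩ : e x + ε / 2 ∈ e '' {q | e q = e x} := hball (by
    rw [Metric.mem_ball, Real.dist_eq, add_sub_cancel_left, abs_of_pos (half_pos hε)]
    exact half_lt_self hε)
  rw [mem_setOf_eq] at hq
  rw [hq] at hqx
  linarith

end RealChart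

/-! ### Coordinates of the preferred charts of a `1`-manifold -/

section Coord

/-- Local notation: `𝔼 1` is the model space `EuclideanSpace ℝ (Fin 1)`. -/
local notation "𝔼¹" => EuclideanSpace ℝ (Fin 1)

/-- The norm of a vector of `ℝ¹` is the absolute value of its coordinate. [folklore] -/
theorem norm_eq_abs_apply (w : 𝔼¹) : ‖w‖ = |w 0| := by
  rw [EuclideanSpace.norm_eq, Fin.sum_univ_one, Real.norm_eq_abs, sq_abs, Real.sqrt_sq_eq_abs]

/-- A vector of `ℝ¹` is determined by its coordinate. [folklore] -/
theorem eq_of_apply_eq {v w : 𝔼¹} (h : v 0 = w 0) : v = w := by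
  rw [DimOne.eq_smul_e₀ v, DimOne.eq_smul_e₀ w, h]

variable {M : Type*} [TopologicalSpace M] [ChartedSpace 𝔼¹ M]

/-- The coordinate `q ↦ (extChartAt (𝓡 1) x q) 0` of the preferred chart at `x` is continuous on
the chart domain. [folklore] -/
theorem continuousOn_coord (x : M) :
    ContinuousOn (fun q => (extChartAt (𝓡 1) x q) 0) (extChartAt (𝓡 1) x).source :=
  (PiLp.continuous_apply 2 (fun _ : Fin 1 => ℝ) 0).comp_continuousOn (continuousOn_extChartAt x)

/-- The coordinate of the preferred chart at `x` is injective on the chart domain. [folklore] -/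
theorem injOn_coord (x : M) :
    InjOn (fun q => (extChartAt (𝓡 1) x q) 0) (extChartAt (𝓡 1) x).source :=
  fun _ hq _ hq' h => (extChartAt (𝓡 1) x).injOn hq hq' (eq_of_apply_eq h)

/-- The coordinate of the preferred chart at `x` is not locally constant at any point of the
chart domain. [folklore] -/
theorem not_eventually_coord_eq {x y : M} (hy : y ∈ (extChartAt (𝓡 1) x).source) :
    ¬∀ᶠ q in 𝓝 y, (extChartAt (𝓡 1) x q) 0 = (extChartAt (𝓡 1) x y) 0 := by
  intro h
  have hy' : y ∈ (chartAt 𝔼¹ x).source := by rwa [extChartAt_source] at hy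
  have hcoe : ∀ q, extChartAt (𝓡 1) x q = chartAt 𝔼¹ x q := fun q => by
    rw [extChartAt_coe, modelWithCornersSelf_coe, Function.id_comp]
  simp only [hcoe] at h
  have himg : chartAt 𝔼¹ x '' {q | chartAt 𝔼¹ x q 0 = chartAt 𝔼¹ x y 0} ∈ 𝓝 (chartAt 𝔼¹ x y) :=
    (chartAt 𝔼¹ x).image_mem_nhds hy' h
  obtain ⟨ε, hε, hball⟩ := Metric.mem_nhds_iff.1 himg
  obtain ⟨q, hq, hqy⟩ : chartAt 𝔼¹ x y + (ε / 2) • DimOne.e₀ ∈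
      chartAt 𝔼¹ x '' {q | chartAt 𝔼¹ x q 0 = chartAt 𝔼¹ x y 0} := hball (by
    rw [Metric.mem_ball, dist_eq_norm, add_sub_cancel_left, norm_smul, Real.norm_eq_abs,
      abs_of_pos (half_pos hε), norm_eq_abs_apply, DimOne.e₀_apply_zero, abs_one, mul_one]
    exact half_lt_self hε)
  rw [mem_setOf_eq] at hq
  have := congrArg (fun w : 𝔼¹ => w 0) hqy
  simp only [PiLp.add_apply, PiLp.smul_apply, DimOne.e₀_apply_zero, smul_eq_mul, mul_one,
    hq] at this
  linarith

/-! ### The bridge to the smooth structure: same direction iff positive Jacobian -/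

variable [IsManifold (𝓡 1) 1 M]

/-- Elementary sign lemma: if `|α - D β| ≤ (D/2) |β|` with `D > 0` then `α` and `β` have the
same sign. [folklore] -/
theorem sign_iff_of_abs_sub_le {α β D : ℝ} (hD : 0 < D) (h : |α - D * β| ≤ D / 2 * |β|) :
    (α < 0 ↔ β < 0) ∧ (0 < α ↔ 0 < β) := by
  rw [abs_le] at h
  rcases lt_trichotomy β 0 with hβ | rfl | hβ
  · rw [abs_of_neg hβ] at h
    have : α < 0 := by nlinarith [h.2]
    exact ⟨iff_of_true this hβ, iff_of_false (fun h' => this.not_gt h') hβ.not_gt⟩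
  · simp only [mul_zero, sub_zero, abs_zero, neg_zero] at h
    have : α = 0 := le_antisymm h.2 h.1
    subst this
    simp
  · rw [abs_of_pos hβ] at h
    have : 0 < α := by nlinarith [h.1]
    exact ⟨iff_of_false this.not_gt hβ.not_gt, iff_of_true this hβ⟩

/-- **First-order estimate of a change of charts in dimension one.** For `y` in the domain of the
preferred chart at `x`, with `c_x = (extChartAt (𝓡 1) x ·) 0`, `c_y` the two coordinates and
`D = det (tangentCoordChange (𝓡 1) y x y)` the Jacobian at `y` of the change from the chart at
`y` to the chart at `x`: `|c_x q - c_x y - D (c_y q - c_y y)| ≤ (|D|/2) |c_y q - c_y y|` for `q`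
near `y`. This is the differentiability of the chart change at `extChartAt (𝓡 1) y y` (Mathlib's
`hasFDerivWithinAt_tangentCoordChange`) with `ε = |D|/2`, the derivative acting on `ℝ¹` as
multiplication by its determinant. [folklore] -/
theorem eventually_abs_sub_det_mul_le {x y : M} (hy : y ∈ (extChartAt (𝓡 1) x).source) :
    ∀ᶠ q in 𝓝 y,
      |(extChartAt (𝓡 1) x q) 0 - (extChartAt (𝓡 1) x y) 0 -
          LinearMap.det (tangentCoordChange (𝓡 1) y x y : 𝔼¹ →ₗ[ℝ] 𝔼¹) *
            ((extChartAt (𝓡 1) y q) 0 - (extChartAt (𝓡 1) y y) 0)| ≤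
        |LinearMap.det (tangentCoordChange (𝓡 1) y x y : 𝔼¹ →ₗ[ℝ] 𝔼¹)| / 2 *
          |(extChartAt (𝓡 1) y q) 0 - (extChartAt (𝓡 1) y y) 0| := by
  set L := tangentCoordChange (𝓡 1) y x y with hL
  set D := LinearMap.det (L : 𝔼¹ →ₗ[ℝ] 𝔼¹) with hD
  have hmem : y ∈ (extChartAt (𝓡 1) y).source ∩ (extChartAt (𝓡 1) x).source :=
    ⟨mem_extChartAt_source y, hy⟩
  have hD0 : D ≠ 0 := det_tangentCoordChange_ne_zero hmem
  have hderiv : HasFDerivAt ((extChartAt (𝓡 1) x) ∘ (extChartAt (𝓡 1) y).symm) L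
      (extChartAt (𝓡 1) y y) := by
    have h := hasFDerivWithinAt_tangentCoordChange (I := 𝓡 1) hmem
    rwa [ModelWithCorners.range_eq_univ, hasFDerivWithinAt_univ] at h
  have hLw : ∀ w : 𝔼¹, L w = D • w := fun w => DimOne.clm_apply L w
  -- the first-order estimate in the chart, with `ε = |D| / 2`
  have hest := (hderiv.isLittleO.def (half_pos (abs_pos.2 hD0)))
  -- transported to `M` along the (continuous) chart at `y`
  have hest' := (continuousAt_extChartAt (I := 𝓡 1) y).eventually hest
  have hsrc : ∀ᶠ q in 𝓝 y, q ∈ (extChartAt (𝓡 1) y).source ∩ (extChartAt (𝓡 1) x).source :=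
    ((isOpen_extChartAt_source y).inter (isOpen_extChartAt_source x)).mem_nhds hmem
  filter_upwards [hest', hsrc] with q hq hqs
  have h1 : ((extChartAt (𝓡 1) x) ∘ (extChartAt (𝓡 1) y).symm) (extChartAt (𝓡 1) y q) =
      extChartAt (𝓡 1) x q := by
    simp only [Function.comp_apply, (extChartAt (𝓡 1) y).left_inv hqs.1]
  have h2 : ((extChartAt (𝓡 1) x) ∘ (extChartAt (𝓡 1) y).symm) (extChartAt (𝓡 1) y y) =
      extChartAt (𝓡 1) x y := by
    simp only [Function.comp_apply, (extChartAt (𝓡 1) y).left_inv hmem.1]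
  rw [h1, h2, hLw, norm_eq_abs_apply, norm_eq_abs_apply] at hq
  simpa only [PiLp.sub_apply, PiLp.smul_apply, smul_eq_mul] using hq

/-- **Positive Jacobian means same direction.** If `det (tangentCoordChange (𝓡 1) y x y) > 0`
then the coordinates `c_x`, `c_y` of the preferred charts at `x` and `y` have the same direction
at `y`. [folklore] -/
theorem same_coord_of_det_pos {x y : M} (hy : y ∈ (extChartAt (𝓡 1) x).source)
    (hD : 0 < LinearMap.det (tangentCoordChange (𝓡 1) y x y : 𝔼¹ →ₗ[ℝ] 𝔼¹)) :
    ∀ᶠ q in 𝓝 y, ((extChartAt (𝓡 1) x q) 0 < (extChartAt (𝓡 1) x y) 0 ↔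
        (extChartAt (𝓡 1) y q) 0 < (extChartAt (𝓡 1) y y) 0) ∧
      ((extChartAt (𝓡 1) x y) 0 < (extChartAt (𝓡 1) x q) 0 ↔
        (extChartAt (𝓡 1) y y) 0 < (extChartAt (𝓡 1) y q) 0) := by
  filter_upwards [eventually_abs_sub_det_mul_le hy] with q hq
  rw [abs_of_pos hD] at hq
  have h := sign_iff_of_abs_sub_le hD hq
  rw [sub_neg, sub_pos, sub_neg, sub_pos] at h
  exact h

/-- **Negative Jacobian means opposite directions.** If `det (tangentCoordChange (𝓡 1) y x y) < 0`
then the coordinates of the preferred charts at `x` and `y` have opposite directions at `y`.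
[folklore] -/
theorem opp_coord_of_det_neg {x y : M} (hy : y ∈ (extChartAt (𝓡 1) x).source)
    (hD : LinearMap.det (tangentCoordChange (𝓡 1) y x y : 𝔼¹ →ₗ[ℝ] 𝔼¹) < 0) :
    ∀ᶠ q in 𝓝 y, ((extChartAt (𝓡 1) x q) 0 < (extChartAt (𝓡 1) x y) 0 ↔
        (extChartAt (𝓡 1) y y) 0 < (extChartAt (𝓡 1) y q) 0) ∧
      ((extChartAt (𝓡 1) x y) 0 < (extChartAt (𝓡 1) x q) 0 ↔
        (extChartAt (𝓡 1) y q) 0 < (extChartAt (𝓡 1) y y) 0) := by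
  filter_upwards [eventually_abs_sub_det_mul_le hy] with q hq
  set D := LinearMap.det (tangentCoordChange (𝓡 1) y x y : 𝔼¹ →ₗ[ℝ] 𝔼¹) with hDdef
  set α := (extChartAt (𝓡 1) x q) 0 - (extChartAt (𝓡 1) x y) 0 with hα
  set β := (extChartAt (𝓡 1) y q) 0 - (extChartAt (𝓡 1) y y) 0 with hβ
  have hq' : |α - (-D) * (-β)| ≤ (-D) / 2 * |(-β)| := by
    rw [abs_of_neg hD] at hq
    rwa [neg_mul_neg, abs_neg]
  have h := sign_iff_of_abs_sub_le (neg_pos.2 hD) hq'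
  rw [neg_neg_iff_pos, neg_pos, hα, hβ, sub_neg, sub_pos, sub_neg, sub_pos] at h
  exact h

/-- **Same direction iff positive Jacobian.** For `y` in the domain of the preferred chart at `x`
of a `C¹` manifold modelled on `ℝ¹`, the coordinates `c_x`, `c_y` of the preferred charts have the
same direction at `y` iff `0 < det (tangentCoordChange (𝓡 1) y x y)`; the Jacobian does not vanish
(`det_tangentCoordChange_ne_zero`), and a negative one gives opposite directions, incompatible with
the same direction as a chart coordinate is not locally constant. This is the dictionary between
orientations as signs of Jacobians (Hirsch, *Differential Topology*, §4.4) and local orders on a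
`1`-manifold. [cite: HirschDT1976, §4.4] -/
theorem same_coord_iff_det_pos {x y : M} (hy : y ∈ (extChartAt (𝓡 1) x).source) :
    (∀ᶠ q in 𝓝 y, ((extChartAt (𝓡 1) x q) 0 < (extChartAt (𝓡 1) x y) 0 ↔
        (extChartAt (𝓡 1) y q) 0 < (extChartAt (𝓡 1) y y) 0) ∧
      ((extChartAt (𝓡 1) x y) 0 < (extChartAt (𝓡 1) x q) 0 ↔
        (extChartAt (𝓡 1) y y) 0 < (extChartAt (𝓡 1) y q) 0)) ↔
      0 < LinearMap.det (tangentCoordChange (𝓡 1) y x y : 𝔼¹ →ₗ[ℝ] 𝔼¹) := by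
  refine ⟨fun h => ?_, same_coord_of_det_pos hy⟩
  have hD0 : LinearMap.det (tangentCoordChange (𝓡 1) y x y : 𝔼¹ →ₗ[ℝ] 𝔼¹) ≠ 0 :=
    det_tangentCoordChange_ne_zero ⟨mem_extChartAt_source y, hy⟩
  by_contra hle
  have hD : LinearMap.det (tangentCoordChange (𝓡 1) y x y : 𝔼¹ →ₗ[ℝ] 𝔼¹) < 0 :=
    lt_of_le_of_ne (not_lt.1 hle) hD0
  exact not_same_and_opp (not_eventually_coord_eq (mem_extChartAt_source y)) h
    (opp_coord_of_det_neg hy hD)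

end Coord

end OneManifold

end Literature.Topology.FourManifolds
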